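import Summits.Ventures.HodgeRepro2.T5BergmanSchurGeneral

/-!
# The general Schur relation in Rühl's normalisation

`T5BergmanRuhlModel.ruhlInner k Φ₁ Φ₂ = (k-1)/π · ⟨Φ₂, Φ₁⟩_k` is Rühl's inner product `(Φ₁, Φ₂)` on the
model `(k_R, +)` (`k = 2 k_R`), and `act k g` is `T_g`. The general Schur relation
(`T5BergmanSchurGeneral.integral_norm_matrixCoeff_sq_ruhl`) reads in this normalisation

  `∫_G |(Φ, T_g Ψ)|² dμ_R = (Φ, Φ) (Ψ, Ψ) / (k - 1)`   for ALL `Φ, Ψ ∈ A_k`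

(`integral_norm_ruhlInner_act_sq`; `k - 1 = 2 k_R - 1` is the formal degree), the case `Φ = Ψ = 1`
being `T5BergmanRuhlModel.integral_norm_ruhlInner_lowest_act_sq`; on Rühl's orthonormal basis `(5-98)`
the value is `1/(2 k_R - 1)` on EVERY pair (`integral_norm_ruhlInner_basis_act_sq`).

Blind lane: Mathlib + the HodgeRepro2 prefix only; no sorry; axioms ⊆ {propext, Classical.choice,
Quot.sound}.
-/

namespace Summit.Ventures.HodgeRepro2.T5BergmanSchurRuhl

open MeasureTheory MeasureTheory.Measure Metric Filter Topology
open T5PoincareDensity T5SU11Unimodular T5SU11Fibration T5HaarCircle T5SU11CoefficientL2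
open T5BergmanCoefficient T5BergmanPairing T5BergmanUnitary T5BergmanFourier T5BergmanParseval
  T5BergmanRuhlModel T5BergmanMonomialNorm T5BergmanActStable T5BergmanMatrixCoeff
  T5BergmanSchurGeneral
open scoped Real

/-- `|(Φ, T_g Ψ)|² = ((k-1)/π)² |⟨π_k(g) Ψ, Φ⟩_k|²`. -/
theorem norm_ruhlInner_act_sq (k : ℕ) (g : SU11) (Φ Ψ : ℂ → ℂ) :
    ‖ruhlInner k Φ (act k g Ψ)‖ ^ 2 = (((k : ℝ) - 1) / π) ^ 2 * ‖pairing k (act k g Ψ) Φ‖ ^ 2 := by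
  unfold ruhlInner
  rw [norm_mul, mul_pow, Complex.norm_real, Real.norm_eq_abs, sq_abs]

/-- Rühl's inner product is real on the diagonal: `(Φ, Φ) = Re (Φ, Φ)`. -/
lemma ruhlInner_self_eq_re (k : ℕ) (hk : 2 ≤ k) (Φ : ℂ → ℂ) :
    ruhlInner k Φ Φ = ((ruhlInner k Φ Φ).re : ℂ) := by
  apply Complex.ext
  · simp
  · simp [(ruhlInner_self_nonneg k hk Φ).2]

/-- `Re (Φ, Φ) = (k-1)/π · Re ⟨Φ, Φ⟩_k`. -/
lemma ruhlInner_self_re (k : ℕ) (Φ : ℂ → ℂ) :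
    (ruhlInner k Φ Φ).re = (((k : ℝ) - 1) / π) * (pairing k Φ Φ).re := by
  unfold ruhlInner
  rw [Complex.re_ofReal_mul]

/-- Rühl's basis vectors are holomorphic. -/
lemma differentiableOn_ruhlBasis (k n : ℕ) : DifferentiableOn ℂ (ruhlBasis k n) (ball 0 1) := by
  unfold ruhlBasis
  fun_prop

/-- Rühl's basis vectors lie in `A_k`. -/
lemma integrableOn_ruhlBasis (k n : ℕ) :
    IntegrableOn (fun w => ‖ruhlBasis k n w‖ ^ 2 * (1 - ‖w‖ ^ 2) ^ (k - 2)) (ball (0 : ℂ) 1) := by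
  have h : IntegrableOn (fun w : ℂ => ‖((Real.sqrt ((n + k - 1).choose n) : ℝ) : ℂ)‖ ^ 2 *
      (‖w ^ n‖ ^ 2 * (1 - ‖w‖ ^ 2) ^ (k - 2))) (ball (0 : ℂ) 1) :=
    (integrableOn_monomial k n).const_mul _
  refine h.congr_fun (fun w _ => ?_) measurableSet_ball
  unfold ruhlBasis
  rw [norm_mul, mul_pow]
  ring

variable [MeasurableSpace Circle] [BorelSpace Circle]

/-- **The general Schur relation in Rühl's normalisation**:
`∫_G |(Φ, T_g Ψ)|² dμ_R = (Φ, Φ) (Ψ, Ψ) / (k - 1)` for all holomorphic `Φ, Ψ ∈ A_k`, `k ≥ 2`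
(`k - 1 = 2 k_R - 1` is the formal degree of `(k_R, +)`). -/
theorem integral_norm_ruhlInner_act_sq (k : ℕ) (hk : 2 ≤ k) (Φ Ψ : ℂ → ℂ)
    (hΦ : DifferentiableOn ℂ Φ (ball 0 1))
    (hΦint : IntegrableOn (fun w => ‖Φ w‖ ^ 2 * (1 - ‖w‖ ^ 2) ^ (k - 2)) (ball (0 : ℂ) 1))
    (hΨ : DifferentiableOn ℂ Ψ (ball 0 1))
    (hΨint : IntegrableOn (fun w => ‖Ψ w‖ ^ 2 * (1 - ‖w‖ ^ 2) ^ (k - 2)) (ball (0 : ℂ) 1)) :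
    ∫ g, ‖ruhlInner k Φ (act k g Ψ)‖ ^ 2 ∂ruhl =
      (ruhlInner k Φ Φ).re * (ruhlInner k Ψ Ψ).re / ((k : ℝ) - 1) := by
  have hs := schur k hk Ψ Φ hΨ hΨint hΦ hΦint
  simp_rw [norm_ruhlInner_act_sq]
  rw [integral_const_mul, hs, ruhlInner_self_re, ruhlInner_self_re]
  ring

/-- The integrand is `μ_R`-integrable. -/
theorem integrable_norm_ruhlInner_act_sq (k : ℕ) (hk : 2 ≤ k) (Φ Ψ : ℂ → ℂ)
    (hΦ : DifferentiableOn ℂ Φ (ball 0 1))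
    (hΦint : IntegrableOn (fun w => ‖Φ w‖ ^ 2 * (1 - ‖w‖ ^ 2) ^ (k - 2)) (ball (0 : ℂ) 1))
    (hΨ : DifferentiableOn ℂ Ψ (ball 0 1))
    (hΨint : IntegrableOn (fun w => ‖Ψ w‖ ^ 2 * (1 - ‖w‖ ^ 2) ^ (k - 2)) (ball (0 : ℂ) 1)) :
    Integrable (fun g => ‖ruhlInner k Φ (act k g Ψ)‖ ^ 2) ruhl := by
  simp_rw [norm_ruhlInner_act_sq]
  exact (integrable_norm_matrixCoeff_sq k hk Ψ Φ hΨ hΨint hΦ hΦint).const_mul _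

/-- **`(5-99)` on every pair**: `∫_G |(Φ_q, T_g Φ_{q'})|² dμ_R = 1/(2 k_R - 1)` for Rühl's orthonormal
basis `Φ_q = N_q^k w^{q-k}` (`ruhlBasis k n`, `n = q - k_R`), for ALL `n, n'`. -/
theorem integral_norm_ruhlInner_basis_act_sq (k : ℕ) (hk : 2 ≤ k) (n n' : ℕ) :
    ∫ g, ‖ruhlInner k (ruhlBasis k n) (act k g (ruhlBasis k n'))‖ ^ 2 ∂ruhl = 1 / ((k : ℝ) - 1) := by
  rw [integral_norm_ruhlInner_act_sq k hk _ _ (differentiableOn_ruhlBasis k n)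
    (integrableOn_ruhlBasis k n) (differentiableOn_ruhlBasis k n') (integrableOn_ruhlBasis k n'),
    ruhlInner_basis_self k hk n, ruhlInner_basis_self k hk n', Complex.one_re, one_mul]

end Summit.Ventures.HodgeRepro2.T5BergmanSchurRuhl
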